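import Literature.Analysis.TotalPositivity.PolyaFrequencyFunctions
import Mathlib.Analysis.SpecialFunctions.Log.Summable
import Mathlib.Analysis.Complex.Exponential
import Mathlib.Topology.Order.MonotoneConvergence
import HarnessLib

/-!
# Estimates for Schoenberg's canonical products `∏ (1 + δ_ν s) e^{−δ_ν s}`, `Σ δ_ν² < ∞`

Trunk `Literature/Analysis/TotalPositivity`, fifth proofs file accompanying
`PolyaFrequencyFunctions.lean` (the named fact `schoenberg1951_pf_laplace`): the elementary
analysis of the genus-one canonical product appearing in Schoenberg's form (7),
`P(s) = ∏_ν (1 + d_ν s) e^{−d_ν s}` with real `d_ν`, `Σ d_ν² < ∞`, needed for the passage from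
finitely many factors (`PolyaFrequencyFiniteProduct.lean`) to the general function (7):

* the primary factor `(1 + z)e^{−z}` is `1 + O(z²)`: `‖(1 + z)e^{−z} − 1‖ ≤ 3‖z‖²` for
  `‖z‖ ≤ 1` (`norm_linExp_sub_one_le`); hence the product converges absolutely for every `s`
  (`multipliable_linExp`, Mathlib's `multipliable_one_add_of_summable`), the partial products
  over `ν < N` converge to Mathlib's `∏'` (`tendsto_prod_range_linExp`), and `P(s) ≠ 0` off the
  real zeros `−1/d_ν`, in particular on the strip `|Re s| < ρ` when `ρ|d_ν| ≤ 1`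
  (`tprod_linExp_ne_zero`);
* on the real axis the factors satisfy `0 < (1 + d c)e^{−dc} ≤ 1` (`|c| < ρ`), so the real
  partial products DEcrease to `P(c) > 0` and are bounded below by it
  (`tprod_le_prod_range_linExp_real`);
* on the vertical line `Re s = c` each factor has modulus
  `(1 + dc) e^{−dc} √(1 + (d Im s/(1 + dc))²) ≥ (1 + dc)e^{−dc}`, whence the lower bound
  `‖∏_{ν<N} (1 + d_ν s)e^{−d_ν s}‖ ≥ P(c) (1 + |b₁ b₂| (Im s)²)` uniformly in `N > ν₁, ν₂` for any
  two indices with `d_{ν₁}, d_{ν₂} ≠ 0`, `b_i = d_{ν_i}/(1 + d_{ν_i} c)`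
  (`norm_prod_range_linExp_ge`) — the integrable majorant `1/(1 + βτ²)` for the reciprocal
  transforms on vertical lines used in the limit `N → ∞`.

## References

* I. J. Schoenberg, *On Pólya frequency functions. I*, J. Analyse Math. 1 (1951) 331–374, §§2–3
  (the class of entire functions (7)). [Schoenberg1951]
* I. I. Hirschman, D. V. Widder, *The Convolution Transform*, Princeton 1955, Ch. III §§2–3
  (the non-finite kernels: convergence and estimates of `∏ (1 − s/a_k)e^{s/a_k}`). [folklore]
-/

noncomputable section

open Filter Complex
open scoped Topology

namespace Literature.Analysis.TotalPositivity

/-! ### The primary factor `(1 + z) e^{−z}` -/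

/-- **The genus-one primary factor is `1 + O(z²)`**: `‖(1 + z)e^{−z} − 1‖ ≤ 3‖z‖²` for
`‖z‖ ≤ 1` (write it as `(e^{−z} − 1 + z) + z (e^{−z} − 1)`). [folklore] -/
theorem norm_linExp_sub_one_le {z : ℂ} (hz : ‖z‖ ≤ 1) :
    ‖(1 + z) * Complex.exp (-z) - 1‖ ≤ 3 * ‖z‖ ^ 2 := by
  have hz' : ‖-z‖ ≤ 1 := by simpa using hz
  have h1 := Complex.norm_exp_sub_one_sub_id_le hz'
  have h2 := Complex.norm_exp_sub_one_le hz'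
  rw [norm_neg] at h1 h2
  have heq : (1 + z) * Complex.exp (-z) - 1 =
      (Complex.exp (-z) - 1 - -z) + z * (Complex.exp (-z) - 1) := by ring
  rw [heq]
  calc ‖(Complex.exp (-z) - 1 - -z) + z * (Complex.exp (-z) - 1)‖
      ≤ ‖Complex.exp (-z) - 1 - -z‖ + ‖z * (Complex.exp (-z) - 1)‖ := norm_add_le _ _
    _ ≤ ‖z‖ ^ 2 + ‖z‖ * (2 * ‖z‖) := by
        rw [norm_mul]
        exact add_le_add h1 (mul_le_mul_of_nonneg_left h2 (norm_nonneg _))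
    _ = 3 * ‖z‖ ^ 2 := by ring

/-- A square-summable real sequence tends to `0`. [folklore] -/
theorem tendsto_zero_of_summable_sq {d : ℕ → ℝ} (hd : Summable fun ν => d ν ^ 2) :
    Tendsto d atTop (𝓝 0) := by
  have h := hd.tendsto_atTop_zero
  rw [tendsto_zero_iff_abs_tendsto_zero]
  have h2 : Tendsto (fun ν => Real.sqrt (d ν ^ 2)) atTop (𝓝 (Real.sqrt 0)) :=
    (Real.continuous_sqrt.tendsto 0).comp h
  rw [Real.sqrt_zero] at h2
  refine h2.congr fun ν => ?_
  simp [Real.sqrt_sq_eq_abs]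

/-- **Absolute convergence**: `Σ_ν ‖(1 + d_ν s)e^{−d_ν s} − 1‖ < ∞` for every `s` when
`Σ d_ν² < ∞`. [cite: Schoenberg1951, §2] [folklore] -/
theorem summable_norm_linExp_sub_one {d : ℕ → ℝ} (hd : Summable fun ν => d ν ^ 2) (s : ℂ) :
    Summable fun ν => ‖(1 + (d ν : ℂ) * s) * Complex.exp (-((d ν : ℂ) * s)) - 1‖ := by
  have h0 : Tendsto (fun ν => d ν ^ 2 * ‖s‖ ^ 2) atTop (𝓝 0) := by
    simpa using hd.tendsto_atTop_zero.mul_const (‖s‖ ^ 2)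
  have hev : ∀ᶠ ν in atTop, ‖(d ν : ℂ) * s‖ ≤ 1 := by
    filter_upwards [(tendsto_order.1 h0).2 1 one_pos] with ν hν
    rw [← sq_le_one_iff₀ (norm_nonneg _), norm_mul, mul_pow, Complex.norm_real, Real.norm_eq_abs,
      sq_abs]
    exact hν.le
  refine Summable.of_norm_bounded_eventually_nat ((hd.mul_right (‖s‖ ^ 2)).mul_left 3) ?_
  filter_upwards [hev] with ν hν
  rw [norm_norm]
  calc ‖(1 + (d ν : ℂ) * s) * Complex.exp (-((d ν : ℂ) * s)) - 1‖
      ≤ 3 * ‖(d ν : ℂ) * s‖ ^ 2 := norm_linExp_sub_one_le hν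
    _ = 3 * (d ν ^ 2 * ‖s‖ ^ 2) := by
        rw [norm_mul, mul_pow, Complex.norm_real, Real.norm_eq_abs, sq_abs]

/-- **The canonical product converges** (unconditionally, in Mathlib's sense) for every `s`.
[cite: Schoenberg1951, §2] [folklore] -/
theorem multipliable_linExp {d : ℕ → ℝ} (hd : Summable fun ν => d ν ^ 2) (s : ℂ) :
    Multipliable fun ν => (1 + (d ν : ℂ) * s) * Complex.exp (-((d ν : ℂ) * s)) := by
  have h := multipliable_one_add_of_summable (summable_norm_linExp_sub_one hd s)
  convert h using 2 with ν
  ring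

/-- The partial products over `ν < N` converge to `∏'`. [folklore] -/
theorem tendsto_prod_range_linExp {d : ℕ → ℝ} (hd : Summable fun ν => d ν ^ 2) (s : ℂ) :
    Tendsto (fun N => ∏ ν ∈ Finset.range N, (1 + (d ν : ℂ) * s) * Complex.exp (-((d ν : ℂ) * s)))
      atTop (𝓝 (∏' ν, (1 + (d ν : ℂ) * s) * Complex.exp (-((d ν : ℂ) * s)))) :=
  (multipliable_linExp hd s).hasProd.tendsto_prod_nat

/-- On the strip `|Re s| < ρ`, `ρ|d| ≤ 1`, the linear factor `1 + ds` does not vanish (its zero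
`−1/d` is real with `|−1/d| ≥ ρ`). [folklore] -/
theorem one_add_mul_ne_zero_of_abs_re_lt {d ρ : ℝ} (hρd : ρ * |d| ≤ 1) {s : ℂ}
    (hs : |s.re| < ρ) : 1 + (d : ℂ) * s ≠ 0 := by
  intro h
  have hre := congrArg Complex.re h
  simp only [Complex.add_re, Complex.one_re, Complex.re_ofReal_mul, Complex.zero_re] at hre
  by_cases hd0 : d = 0
  · rw [hd0] at hre
    norm_num at hre
  · have h1 : |d| * |s.re| = 1 := by
      rw [← abs_mul]
      have : d * s.re = -1 := by linarith
      rw [this]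
      norm_num
    have h2 : |d| * |s.re| < |d| * ρ := mul_lt_mul_of_pos_left hs (abs_pos.2 hd0)
    nlinarith

/-- The real linear factor is positive on `|c| < ρ`, `ρ|d| ≤ 1`. [folklore] -/
theorem one_add_mul_pos_of_abs_lt {d ρ c : ℝ} (hρd : ρ * |d| ≤ 1) (hc : |c| < ρ) :
    0 < 1 + d * c := by
  have h1 : |d * c| < 1 := by
    by_cases hd0 : d = 0
    · simp [hd0]
    · rw [abs_mul]
      calc |d| * |c| < |d| * ρ := mul_lt_mul_of_pos_left hc (abs_pos.2 hd0)
        _ = ρ * |d| := mul_comm _ _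
        _ ≤ 1 := hρd
  have := neg_abs_le (d * c)
  linarith

/-- **`P(s) ≠ 0` on the strip `|Re s| < ρ`** (`ρ|d_ν| ≤ 1` for all `ν`): an absolutely convergent
product with non-zero factors is non-zero. [cite: Schoenberg1951, §2] [folklore] -/
theorem tprod_linExp_ne_zero {d : ℕ → ℝ} (hd : Summable fun ν => d ν ^ 2) {ρ : ℝ}
    (hρd : ∀ ν, ρ * |d ν| ≤ 1) {s : ℂ} (hs : |s.re| < ρ) :
    ∏' ν, (1 + (d ν : ℂ) * s) * Complex.exp (-((d ν : ℂ) * s)) ≠ 0 := by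
  have h := tprod_one_add_ne_zero_of_summable
    (f := fun ν => (1 + (d ν : ℂ) * s) * Complex.exp (-((d ν : ℂ) * s)) - 1)
    (fun ν => by
      have h1 := one_add_mul_ne_zero_of_abs_re_lt (hρd ν) hs
      have h2 := Complex.exp_ne_zero (-((d ν : ℂ) * s))
      convert mul_ne_zero h1 h2 using 1
      ring)
    (summable_norm_linExp_sub_one hd s)
  simpa using h

/-! ### The factors on the real axis -/

/-- `(1 + x) e^{−x} ≤ 1` for all real `x`. [folklore] -/
theorem linExp_real_le_one (x : ℝ) : (1 + x) * Real.exp (-x) ≤ 1 := by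
  have h := Real.add_one_le_exp x
  rw [Real.exp_neg, ← div_eq_mul_inv, div_le_one (Real.exp_pos x)]
  linarith

/-- The real partial products `∏_{ν<N} (1 + d_ν c)e^{−d_ν c}` are antitone in `N` when all
factors are positive (each is `≤ 1`). [folklore] -/
theorem antitone_prod_range_linExp_real {d : ℕ → ℝ} {c : ℝ} (hpos : ∀ ν, 0 < 1 + d ν * c) :
    Antitone fun N => ∏ ν ∈ Finset.range N, (1 + d ν * c) * Real.exp (-(d ν * c)) := by
  refine antitone_nat_of_succ_le fun N => ?_
  rw [Finset.prod_range_succ]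
  refine mul_le_of_le_one_right (Finset.prod_nonneg fun ν _ =>
    mul_nonneg (hpos ν).le (Real.exp_pos _).le) (linExp_real_le_one _)

/-- The real canonical product converges. [folklore] -/
theorem multipliable_linExp_real {d : ℕ → ℝ} (hd : Summable fun ν => d ν ^ 2) (c : ℝ) :
    Multipliable fun ν => (1 + d ν * c) * Real.exp (-(d ν * c)) := by
  have hs : Summable fun ν => ‖(1 + d ν * c) * Real.exp (-(d ν * c)) - 1‖ := by
    refine (summable_norm_linExp_sub_one hd (c : ℂ)).congr fun ν => ?_
    rw [← Complex.norm_real]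
    push_cast
    rfl
  have h := multipliable_one_add_of_summable hs
  have heq : (fun ν => (1 + d ν * c) * Real.exp (-(d ν * c))) =
      fun ν => 1 + ((1 + d ν * c) * Real.exp (-(d ν * c)) - 1) := by
    funext ν
    ring
  rw [heq]
  exact h

/-- The real product as the complex one at a real point: for real `c`,
`∏' (1 + d_ν c)e^{−d_ν c}` (complex) `= ↑(∏' … )` (real). [folklore] -/
theorem tprod_linExp_ofReal {d : ℕ → ℝ} (hd : Summable fun ν => d ν ^ 2) (c : ℝ) :
    ∏' ν, (1 + (d ν : ℂ) * (c : ℂ)) * Complex.exp (-((d ν : ℂ) * (c : ℂ))) =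
      ((∏' ν, (1 + d ν * c) * Real.exp (-(d ν * c)) : ℝ) : ℂ) := by
  have h := ((multipliable_linExp_real hd c).hasProd.map Complex.ofRealHom
    Complex.continuous_ofReal).tprod_eq
  rw [Complex.ofRealHom_eq_coe] at h
  rw [← h]
  exact tprod_congr fun ν => by simp [Function.comp_apply, Complex.ofReal_exp]

/-- **The real partial products dominate the limit**: for `|c| < ρ` (`ρ|d_ν| ≤ 1`),
`0 < P(c) = ∏' (1 + d_ν c)e^{−d_ν c} ≤ ∏_{ν<N} (1 + d_ν c)e^{−d_ν c}` for every `N`.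
[folklore] -/
theorem tprod_le_prod_range_linExp_real {d : ℕ → ℝ} (hd : Summable fun ν => d ν ^ 2) {ρ c : ℝ}
    (hρd : ∀ ν, ρ * |d ν| ≤ 1) (hc : |c| < ρ) (N : ℕ) :
    0 < ∏' ν, (1 + d ν * c) * Real.exp (-(d ν * c)) ∧
      ∏' ν, (1 + d ν * c) * Real.exp (-(d ν * c)) ≤
        ∏ ν ∈ Finset.range N, (1 + d ν * c) * Real.exp (-(d ν * c)) := by
  have hpos : ∀ ν, 0 < 1 + d ν * c := fun ν => one_add_mul_pos_of_abs_lt (hρd ν) hc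
  -- convergence of the real partial products
  have hsC : |((c : ℂ)).re| < ρ := by simpa using hc
  have ht : Tendsto (fun N => ∏ ν ∈ Finset.range N, (1 + d ν * c) * Real.exp (-(d ν * c)))
      atTop (𝓝 (∏' ν, (1 + d ν * c) * Real.exp (-(d ν * c)))) :=
    (multipliable_linExp_real hd c).hasProd.tendsto_prod_nat
  have hle := (antitone_prod_range_linExp_real hpos).le_of_tendsto ht
  refine ⟨?_, hle N⟩
  -- positivity of the limit: it is non-zero (complex product) and a limit of positive numbers
  have hne : (∏' ν, (1 + d ν * c) * Real.exp (-(d ν * c))) ≠ 0 := by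
    have h := tprod_linExp_ne_zero hd hρd hsC
    rw [tprod_linExp_ofReal hd] at h
    exact_mod_cast h
  have hge : 0 ≤ ∏' ν, (1 + d ν * c) * Real.exp (-(d ν * c)) :=
    ge_of_tendsto' ht fun N => Finset.prod_nonneg fun ν _ =>
      mul_nonneg (hpos ν).le (Real.exp_pos _).le
  exact lt_of_le_of_ne hge hne.symm

/-! ### The factors on vertical lines -/

/-- **Modulus of a factor on the line `Re s = c`**:
`‖(1 + ds)e^{−ds}‖ = (1 + dc) e^{−dc} √(1 + (d Im s/(1 + dc))²)` when `1 + dc > 0`. [folklore] -/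
theorem norm_linExp_eq {d : ℝ} {s : ℂ} (hpos : 0 < 1 + d * s.re) :
    ‖(1 + (d : ℂ) * s) * Complex.exp (-((d : ℂ) * s))‖ =
      (1 + d * s.re) * Real.exp (-(d * s.re)) *
        Real.sqrt (1 + (d * s.im / (1 + d * s.re)) ^ 2) := by
  rw [norm_mul, Complex.norm_exp]
  have hre : (-((d : ℂ) * s)).re = -(d * s.re) := by simp
  rw [hre]
  have hnorm : ‖1 + (d : ℂ) * s‖ = (1 + d * s.re) * Real.sqrt (1 + (d * s.im / (1 + d * s.re)) ^ 2) := by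
    have h1 : ‖1 + (d : ℂ) * s‖ = Real.sqrt ((1 + d * s.re) ^ 2 + (d * s.im) ^ 2) := by
      rw [← Real.sqrt_sq (norm_nonneg _), Complex.sq_norm, Complex.normSq_apply]
      congr 1
      simp only [Complex.add_re, Complex.one_re, Complex.re_ofReal_mul, Complex.add_im,
        Complex.one_im, Complex.im_ofReal_mul, zero_add]
      ring
    rw [h1, ← Real.sqrt_sq hpos.le, ← Real.sqrt_mul (sq_nonneg _), Real.sqrt_sq hpos.le]
    congr 1
    field_simp
  rw [hnorm]
  ring

/-- Each factor on `Re s = c` dominates its value at `c`: with `1 + dc > 0`,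
`(1 + dc)e^{−dc} ≤ ‖(1 + ds)e^{−ds}‖`. [folklore] -/
theorem linExp_real_le_norm {d : ℝ} {s : ℂ} (hpos : 0 < 1 + d * s.re) :
    (1 + d * s.re) * Real.exp (-(d * s.re)) ≤ ‖(1 + (d : ℂ) * s) * Complex.exp (-((d : ℂ) * s))‖ := by
  rw [norm_linExp_eq hpos]
  refine le_mul_of_one_le_right (mul_nonneg hpos.le (Real.exp_pos _).le) ?_
  rw [Real.one_le_sqrt]
  nlinarith [sq_nonneg (d * s.im / (1 + d * s.re))]

/-- `√(1 + u²) √(1 + v²) ≥ 1 + |uv|`. [folklore] -/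
theorem one_add_abs_mul_le_sqrt_mul_sqrt (u v : ℝ) :
    1 + |u * v| ≤ Real.sqrt (1 + u ^ 2) * Real.sqrt (1 + v ^ 2) := by
  have h1 : (0 : ℝ) ≤ 1 + u ^ 2 := by positivity
  have hkey : (1 + |u * v|) ^ 2 ≤ (1 + u ^ 2) * (1 + v ^ 2) := by
    rw [abs_mul]
    nlinarith [sq_nonneg (|u| - |v|), sq_abs u, sq_abs v, abs_nonneg u, abs_nonneg v]
  calc 1 + |u * v| = Real.sqrt ((1 + |u * v|) ^ 2) := (Real.sqrt_sq (by positivity)).symm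
    _ ≤ Real.sqrt ((1 + u ^ 2) * (1 + v ^ 2)) := Real.sqrt_le_sqrt hkey
    _ = Real.sqrt (1 + u ^ 2) * Real.sqrt (1 + v ^ 2) := Real.sqrt_mul h1 _

/-- **Lower bound for the partial products on the line `Re s = c`.**  Let `Σ d_ν² < ∞`,
`ρ|d_ν| ≤ 1`, `|c| < ρ` with `c = Re s`, and let `ν₁ ≠ ν₂` be indices with `d_{ν₁}, d_{ν₂} ≠ 0`.
Then for every `N > ν₁, ν₂`,
`‖∏_{ν<N} (1 + d_ν s)e^{−d_ν s}‖ ≥ P(c) · (1 + |b₁ b₂| (Im s)²)`, `b_i = d_{ν_i}/(1 + d_{ν_i} c)`,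
`P(c) = ∏' (1 + d_ν c)e^{−d_ν c} > 0`. [cite: Schoenberg1951, §3] [folklore] -/
theorem norm_prod_range_linExp_ge {d : ℕ → ℝ} (hd : Summable fun ν => d ν ^ 2) {ρ : ℝ}
    (hρd : ∀ ν, ρ * |d ν| ≤ 1) {s : ℂ} (hs : |s.re| < ρ) {ν₁ ν₂ : ℕ} (hne : ν₁ ≠ ν₂)
    {N : ℕ} (h1 : ν₁ < N) (h2 : ν₂ < N) :
    (∏' ν, (1 + d ν * s.re) * Real.exp (-(d ν * s.re))) *
        (1 + |d ν₁ / (1 + d ν₁ * s.re) * (d ν₂ / (1 + d ν₂ * s.re))| * s.im ^ 2) ≤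
      ‖∏ ν ∈ Finset.range N, (1 + (d ν : ℂ) * s) * Complex.exp (-((d ν : ℂ) * s))‖ := by
  classical
  have hpos : ∀ ν, 0 < 1 + d ν * s.re := fun ν => one_add_mul_pos_of_abs_lt (hρd ν) hs
  set c := s.re with hc
  set τ := s.im with hτ
  set b : ℕ → ℝ := fun ν => d ν * τ / (1 + d ν * c) with hb
  set q : ℕ → ℝ := fun ν => (1 + d ν * c) * Real.exp (-(d ν * c)) with hq
  set r : ℕ → ℝ := fun ν => Real.sqrt (1 + b ν ^ 2) with hr
  have hq0 : ∀ ν, 0 ≤ q ν := fun ν => mul_nonneg (hpos ν).le (Real.exp_pos _).le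
  have hr1 : ∀ ν, 1 ≤ r ν := fun ν => by
    rw [hr, Real.one_le_sqrt]
    nlinarith [sq_nonneg (b ν)]
  -- the norm of the partial product, factorised
  rw [norm_prod]
  have hfac : ∀ ν, ‖(1 + (d ν : ℂ) * s) * Complex.exp (-((d ν : ℂ) * s))‖ = q ν * r ν := fun ν =>
    norm_linExp_eq (hpos ν)
  simp only [hfac, Finset.prod_mul_distrib]
  obtain ⟨hP0, hPle⟩ := tprod_le_prod_range_linExp_real hd hρd hs N
  -- the `r`-product contains the two special factors, all others are `≥ 1`
  have hrprod : r ν₁ * r ν₂ ≤ ∏ ν ∈ Finset.range N, r ν := by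
    have hsub : ({ν₁, ν₂} : Finset ℕ) ⊆ Finset.range N := by
      intro ν hν
      simp only [Finset.mem_insert, Finset.mem_singleton] at hν
      rcases hν with rfl | rfl <;> simpa
    rw [← Finset.prod_sdiff hsub, Finset.prod_pair hne]
    exact le_mul_of_one_le_left (mul_nonneg (zero_le_one.trans (hr1 _))
      (zero_le_one.trans (hr1 _))) (Finset.one_le_prod fun ν _ => hr1 ν)
  have hspecial : 1 + |d ν₁ / (1 + d ν₁ * c) * (d ν₂ / (1 + d ν₂ * c))| * τ ^ 2 ≤ r ν₁ * r ν₂ := by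
    have h := one_add_abs_mul_le_sqrt_mul_sqrt (b ν₁) (b ν₂)
    have hbb : |b ν₁ * b ν₂| = |d ν₁ / (1 + d ν₁ * c) * (d ν₂ / (1 + d ν₂ * c))| * τ ^ 2 := by
      rw [hb]
      simp only
      rw [show d ν₁ * τ / (1 + d ν₁ * c) * (d ν₂ * τ / (1 + d ν₂ * c)) =
        (d ν₁ / (1 + d ν₁ * c) * (d ν₂ / (1 + d ν₂ * c))) * τ ^ 2 by ring, abs_mul,
        abs_of_nonneg (sq_nonneg τ)]
    rw [hbb] at h
    exact h
  calc (∏' ν, q ν) * (1 + |d ν₁ / (1 + d ν₁ * c) * (d ν₂ / (1 + d ν₂ * c))| * τ ^ 2)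
      ≤ (∏ ν ∈ Finset.range N, q ν) * (r ν₁ * r ν₂) :=
        mul_le_mul hPle hspecial (by positivity) (Finset.prod_nonneg fun ν _ => hq0 ν)
    _ ≤ (∏ ν ∈ Finset.range N, q ν) * ∏ ν ∈ Finset.range N, r ν :=
        mul_le_mul_of_nonneg_left hrprod (Finset.prod_nonneg fun ν _ => hq0 ν)

end Literature.Analysis.TotalPositivity

end
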